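import Summits.ABC.StewartYu.PadicG3VbHalfLine
import Summits.ABC.StewartYu.PadicG3ExpLineP
import Summits.ABC.StewartYu.PadicG3CountRb
import HarnessLib

/-!
# Cell abc-stewartyu, crux `Y07Odd` (stmt-ABC-19658), `m = 0` branch: THE INEQUALITY PACK `IneqPackR₃` at `P.schedVb 1` from the stub context
# (= the registered stub `stub_ineqsV` of the skeleton `Lines/gen3-slab-odd.lean`, all hypotheses verbatim)

`Summits/ABC/StewartYu/PadicG3VbPack.lean` — cell `abc-stewartyu` (seat p3-g7).  Theorems only, no named fact.
`ineqPackR₃_schedVb_one`: under the crux context (odd `p`, a Gen-3 datum `S` of rank `n ≥ 2`, heights `h(αⱼ) ≤ Vⱼ`, `1 ≤ Vⱼ ≤ Vmax`,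
`log max(3,|bⱼ|) ≤ W`, `1 ≤ W`, the NEGATED BOUND with constant `(2^100)ⁿ`, and a parameter record `P` with `P.p = p`, `A = V`, `Amax ≤ Vmax`,
`Amax ≤ 2ⁿ∏V`, `W`, `Nq = K`, `K₀ = p − 1`, `θ₀ = ½`, `m = 0`): `∃ b, 1 ≤ b ∧ S.IneqPackR₃ (P.schedVb b)` — at `b := 1`: (B1) = lp-1's
`startCountR₂_schedVb_one`; the order `U := E·log p` with `‖Λ/b_{j₀}‖ ≤ (p^E)⁻¹`, `8·2ⁿ·Zp + CondFloorV n ≤ E·log p` = p2's `expLine_V` (on p1's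
`headline_V100_div_log_lit`); the three k-step families = `kstep_line_Vb`; the half-step family = `half_line_Vb`.

References: Yu. V. Nesterenko, LNM 1819 (2003) Prop. 4.1, §4; K. Yu, Acta Math. 211 (2013) §3, §7.
-/

noncomputable section

open Finset Real
open Literature.NumberTheory.Transcendental
open Literature.NumberTheory.Transcendental.PadicCW77 (condExp)
open Literature.NumberTheory.Transcendental.CW77.Setup (Tau tauNorm)

namespace Summit.ABC.StewartYu

namespace G3Setup

variable {p : ℕ} [Fact p.Prime] (S : G3Setup p)

set_option maxHeartbeats 400000 in
/-- **THE `m = 0` INEQUALITY PACK** (registered stub `stub_ineqsV` of crux `Y07Odd`, hypotheses verbatim).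
[cite: Nesterenko2003, Prop 4.1, Lemma 4.3, §4.3; shape only] -/
theorem ineqPackR₃_schedVb_one (hn2 : 2 ≤ S.n) (V : Fin S.n → ℝ) (Vmax W : ℝ)
    (hV : ∀ j, Height.logHeight₁ (S.α j) ≤ V j) (hV1 : ∀ j, 1 ≤ V j)
    (hWb : ∀ j, Real.log (max 3 (|S.b j| : ℝ)) ≤ W)
    (hU : ¬ (padicValRat p (∏ j, S.α j ^ S.b j - 1) : ℝ) * Real.log p ≤
        ((2 : ℝ) ^ 100) ^ S.n * ((p : ℝ) / Real.log p) * (∏ j, V j) * (W + Real.log p + Real.log (2 * Vmax)))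
    (P : PadicG3Par S.n) (hPp : P.p = p) (hPA : P.A = V) (hAmaxV : P.Amax ≤ Vmax) (hAmaxPr : P.Amax ≤ 2 ^ S.n * ∏ j, V j)
    (hPW : P.W = W) (hNq : P.Nq = P.K) (hK₀ : P.K₀ = p - 1) (hθ : P.θ₀ = 1 / 2) (hm : P.m = 0) :
    ∃ b : ℝ, 1 ≤ b ∧ S.IneqPackR₃ (P.schedVb b) := by
  have hprime : p.Prime := Fact.out
  have hp1 : 1 ≤ p := hprime.one_lt.le
  have hpR : (0 : ℝ) < p := by exact_mod_cast hprime.pos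
  -- the record-side hypotheses in `P`'s letters
  have hA1 : ∀ j, 1 ≤ P.A j := fun j => by rw [hPA]; exact hV1 j
  have hαA : ∀ j, Height.logHeight₁ (S.α j) ≤ P.A j := fun j => by rw [hPA]; exact hV j
  have hbW : ∀ j, Real.log (max 3 (|S.b j| : ℝ)) ≤ P.W := fun j => by rw [hPW]; exact hWb j
  have hK₀r : (P.K₀ : ℝ) = P.p - 1 := by
    rw [hK₀, hPp, Nat.cast_sub hp1]; push_cast; ring
  -- the order `U := E·log p`
  obtain ⟨E, _, hΛE, hEU, _⟩ := S.expLine_V hn2 V Vmax W hV1 hWb hU P hPp hPA hAmaxV hAmaxPr hPW hNq hK₀ hθ hm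
  have hΛU : ‖S.Λ / (S.b S.j₀ : ℚ_[p])‖ ≤ Real.exp (-((E : ℝ) * Real.log p)) := by
    refine hΛE.trans (le_of_eq ?_)
    rw [Real.exp_neg, Real.exp_nat_mul, Real.exp_log hpR]
  refine ⟨1, le_rfl, S.startCountR₂_schedVb_one P hPp hK₀, ?_, ?_, ?_, ?_⟩
  · -- level-0 k-steps
    intro ν hν x₁ hx τ hτ
    have hτ' : tauNorm τ ≤ S.TordS (P.schedVb 1) 0 0 := by
      have := S.TordS_Vb_le_zero P 1 0 ν; omega
    have hE : P.zerosV 0 ν ≤ P.G * (((2 * S.NS (P.schedVb 1) 0 ν + 1) * S.tS (P.schedVb 1) 0 : ℕ) : ℝ) :=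
      P.zerosV_le_gain 0 ν
    exact S.kstep_line_Vb P 1 hPp hm hθ hNq hK₀r hn2 le_rfl hA1 hαA hbW hΛU hEU (Nat.zero_le _) (by omega) hx τ hτ'
      (by omega) le_rfl hE
  · -- Kummer half-steps
    intro lev hlev s₁ _ hs τ hτ
    exact S.half_line_Vb P 1 hPp hm hθ hNq hK₀r hn2 le_rfl hA1 hαA hbW hΛU hEU hlev hs τ hτ
  · -- odd-node k-steps
    intro lev hlev x₁ hx τ hτ
    have hτ' : tauNorm τ ≤ S.TordS (P.schedVb 1) 0 0 := by
      have := S.TordS_Vb_le_zero P 1 (lev + 1) 0; omega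
    have hlev' : lev + 1 ≤ P.SdG := hlev
    have hk1 : 1 ≤ 2 * S.NhS (P.schedVb 1) (lev + 1) := by
      rw [S.NhS_Vb P 1]; have := P.one_le_XsV (lev + 1); omega
    have hk : 2 * S.NhS (P.schedVb 1) (lev + 1) ≤ 2 * S.NS (P.schedVb 1) (lev + 1) 0 + 1 := by
      rw [S.NhS_Vb P 1, S.NS_Vb P 1, pow_zero, one_mul]; omega
    have hE : P.zerosV (lev + 1) 0 ≤ P.G * (((2 * S.NhS (P.schedVb 1) (lev + 1)) * S.tS (P.schedVb 1) (lev + 1) : ℕ) : ℝ) := by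
      rw [S.NhS_Vb P 1, S.tS_Vb P 1]
      unfold PadicG3Par.zerosV
      push_cast
      ring_nf
      exact le_rfl
    exact S.kstep_line_Vb P 1 hPp hm hθ hNq hK₀r hn2 le_rfl hA1 hαA hbW hΛU hEU hlev' (by omega) hx τ hτ' hk1 hk hE
  · -- symmetric k-steps of the levels ≥ 1
    intro lev hlev ν hν1 hνn x₁ hx τ hτ
    have hτ' : tauNorm τ ≤ S.TordS (P.schedVb 1) 0 0 := by
      have := S.TordS_Vb_le_zero P 1 (lev + 1) ν; omega
    have hlev' : lev + 1 ≤ P.SdG := hlev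
    have hE : P.zerosV (lev + 1) ν ≤ P.G * (((2 * S.NS (P.schedVb 1) (lev + 1) ν + 1) * S.tS (P.schedVb 1) (lev + 1) : ℕ) : ℝ) :=
      P.zerosV_le_gain (lev + 1) ν
    exact S.kstep_line_Vb P 1 hPp hm hθ hNq hK₀r hn2 le_rfl hA1 hαA hbW hΛU hEU hlev' (by omega) hx τ hτ'
      (by omega) le_rfl hE

end G3Setup

end Summit.ABC.StewartYu

end
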